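import Summits.HodgeConjecture.HodgeConjecture.Theorems.TropicalWeilObstructionTropicalWeilVanishingPrymThree
import Summits.HodgeConjecture.HodgeConjecture.Theorems.TropicalWeilObstructionTropicalWeilVanishingRealisationSystem
import Summits.HodgeConjecture.HodgeConjecture.Theorems.TropicalWeilObstructionTropicalWeilVanishingCalibrationTwoBoundary
import HarnessLib

/-!
# Route `TropicalWeilObstruction` (Kontsevich's tropical test — NEGATION SINK, exploration, no summit claim):
# the `n = 3` calibration reduces to ONE finite certificate at a rational Prym period

Negation-sink bookkeeping of the cell `pub-hodge-tropical` (seat tropical-2 gen 34). Part II of the `PrymThree` series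
(`…TropicalWeilVanishingPrymThree`, p378728) TYPED the `n = 3` calibration of Kontsevich's test as the open
`@[conjecture] TropicalSchoenCalibrationThree`: some tropical Schoen–Prym sixfold of the metric `K_{3,3}` with positive,
algebraically independent edge lengths carries an effective tropical `3`-cycle with Weil functional `W ≠ 0`. On 2026-08-24
both seats of the cell COMPUTED such a cycle — the tropical Schoen cycle `AP_*(Nm⁻¹|K_{Γ'}|)_t` (one sheet of the norm
preimage of the tropical canonical system of the generic metric `K_{3,3}`, 273 three-cells, push-forward weights; HOME
`certificates/schoenK4/` §5, tropical-1 gen 26, and the independent engine `certificates/schoen3-t2/`, tropical-2 gen 34: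
balanced, the balanced weighting is unique, `W(Z_t) = 2¹⁰·det_H(½Q_ℓ|_Λ)·i^{t+1} ≠ 0`) — with exact rational arithmetic,
OUTSIDE the kernel (a `TropicalTorusCycle` certificate of its ≈ 7·10⁴ polytopes per sheet is far beyond the `decide` budget
that carried the 240-cell `n = 2` seed, p356781).

This file records, sorry-free, exactly what such a kernel certificate would have to contain, and that nothing about
genericity is part of it: **`schoenCalibrationThree_of_seed`** — if at ONE rational edge-length vector `ℓ₀ > 0` there is an
effective tropical `3`-cycle `Z₀` on `ℝ⁶/prymPeriod(ℓ₀)·ℤ⁶` with `W(Z₀) ≠ 0` whose combinatorial type is linearly realisable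
in the nine Prym directions `QR e` (the linearised edge/facet system of `…RealisationSystem` has a solution for each
`D = QR e`; for the computed cycle these solutions are the `ℓ_e`-derivatives of the construction, which is affine in `ℓ` on
an open cone), then `TropicalSchoenCalibrationThree` holds. Ingredients: `linearSpread` (p351568's realisation system,
any `n`), the spanning lemma `mem_span_QR` (every symmetric `J`-commuting matrix is a real combination of the `QR e`,
from `prymPeriod_coeffOf` = tropical Koike dominance), continuity of `prymPeriod`, and algebraically independent reals in
every box (`GenericWeilPeriod.exists_algebraicIndependent_real_small`): near `ℓ₀` the spread cycle keeps positive edge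
determinants and `W ≠ 0`, and positive algebraically independent `ℓ` are dense there. Also `continuous_prymPeriod`,
`prymPeriod_eq_sum_smul`, `exists_algebraicIndependent_near`.

HONEST STATUS. A REDUCTION, not a proof of the calibration: `TropicalSchoenCalibrationThree` stays an open `@[conjecture]`
in the tree until a seed certificate is kernel-checked; the computations named above are evidence, not hypotheses of any
theorem here. One dimension below the crux K1 (`TropicalWeilVanishing`, `n = 4`, OPEN); decides nothing about K1, K1_∂, K2
or the Hodge conjecture. No new definition, no named-fact hypothesis, no sorry.
References: [Zharkov2020TropicalWeil] I. Zharkov, arXiv:2002.02347, §2 (pp. 2–4); [MikhalkinZharkov2014Eigenwave]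
G. Mikhalkin, I. Zharkov, LN UMI 15 (2014), Def. 4.2, Prop. 4.3; C. Schoen, Compositio Math. 65 (1988); K. Koike,
Canad. Math. Bull. 47 (2004), §2.
-/

set_option linter.dupNamespace false

noncomputable section

open scoped BigOperators Matrix Topology
open Matrix Literature.AlgebraicGeometry.Tropical

namespace Summit.HodgeConjecture.HodgeConjecture.Theorems.TropicalWeilVanishing

namespace PrymThree

/-! ### The Prym period family: sum form, continuity, spanning -/

/-- `prymPeriod ℓ = Σ_e ℓ_e • QR e` as matrices. [folklore] -/
theorem prymPeriod_eq_sum_smul (ℓ : Fin 9 → ℝ) : prymPeriod ℓ = ∑ e, ℓ e • QR e := by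
  ext a b
  simp only [prymPeriod, Matrix.sum_apply, Matrix.smul_apply, smul_eq_mul]

/-- The Prym period map `ℓ ↦ prymPeriod ℓ` is continuous (it is linear). [folklore] -/
theorem continuous_prymPeriod : Continuous prymPeriod := by
  refine continuous_matrix fun a b => ?_
  simp only [prymPeriod]
  exact continuous_finsetSum _ fun e _ => (continuous_apply e).mul continuous_const

/-- **Spanning (tropical Koike dominance, span form).** Every symmetric real `6 × 6` matrix commuting with `weilJ 3` lies
in the real span of the nine Prym forms `QR e` (it IS `prymPeriod (coeffOf D)`, `prymPeriod_coeffOf`).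
[cite: Zharkov2020TropicalWeil, §2 (pp. 2–4)] -/
theorem mem_span_QR (D : Matrix (Fin 6) (Fin 6) ℝ) (hS : D.IsSymm)
    (hJ : D * (weilJ 3 : Matrix (Fin 6) (Fin 6) ℝ) = (weilJ 3 : Matrix (Fin 6) (Fin 6) ℝ) * D) :
    D ∈ Submodule.span ℝ (Set.range QR) := by
  rw [← prymPeriod_coeffOf D hS hJ, prymPeriod_eq_sum_smul]
  exact Submodule.sum_mem _ fun e _ => Submodule.smul_mem _ _ (Submodule.subset_span ⟨e, rfl⟩)

/-- Algebraically independent (over `ℚ`) real vectors within any prescribed distance of a RATIONAL vector: translate a small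
algebraically independent vector by the rational one (rational affine substitutions preserve algebraic independence).
[folklore] -/
theorem exists_algebraicIndependent_near (ℓ₀ : Fin 9 → ℚ) {δ : ℝ} (hδ : 0 < δ) :
    ∃ ℓ : Fin 9 → ℝ, AlgebraicIndependent ℚ ℓ ∧ ∀ e, |ℓ e - ℓ₀ e| ≤ δ := by
  obtain ⟨y, hy, hsmall⟩ := GenericWeilPeriod.exists_algebraicIndependent_real_small (Fin 9) hδ
  refine ⟨fun e => ((1 : ℚ) : ℝ) * y e + ((ℓ₀ e : ℚ) : ℝ),
    GenericWeilPeriod.algebraicIndependent_affine hy (fun _ => 1) ℓ₀ fun _ => one_ne_zero, fun e => ?_⟩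
  simp only [Rat.cast_one, one_mul, add_sub_cancel_right]
  exact hsmall e

/-! ### The reduction: one rational seed, linearly realisable in the nine Prym directions, gives the calibration -/

/-- **The `n = 3` calibration from ONE finite certificate.** Let `ℓ₀ ∈ ℚ₊⁹` be rational positive edge lengths of the
cover of `K_{3,3}` and `Z₀` an effective tropical `3`-cycle on the tropical Prym `ℝ⁶/prymPeriod(ℓ₀)·ℤ⁶` with
`W(Z₀) ≠ 0`, whose combinatorial type (frames, facet classes, re-orderings, shifts) is LINEARLY REALISABLE in each of the
nine Prym directions `QR e`: the linearised edge equations and facet identifications have a real solution `(v, T, r)`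
with `QR e` in place of the period. Then `TropicalSchoenCalibrationThree` holds: by `linearSpread` the type is realised by
continuous data over every symmetric `J`-commuting matrix (the `QR e` span them, `mem_span_QR`); pulled back along the
continuous map `prymPeriod`, 'positive edge determinants and `W ≠ 0`' is an open condition at `ℓ₀`, and positive
algebraically independent edge lengths exist in every neighbourhood of `ℓ₀` (`exists_algebraicIndependent_near`); over such
an `ℓ` the realised data are an effective tropical `3`-cycle with the same weights and frames, hence `W ≠ 0`. This is the
exact content a kernel certificate of the computed tropical Schoen cycle (HOME `certificates/schoenK4/` §5,
`certificates/schoen3-t2/`) would have to supply; the genericity of the period is not part of it.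
[cite: Zharkov2020TropicalWeil, §2 (pp. 2–4)] [cite: MikhalkinZharkov2014Eigenwave, Def. 4.2 and Prop. 4.3] -/
theorem schoenCalibrationThree_of_seed (ℓ₀ : Fin 9 → ℚ) (hℓ₀ : ∀ e, 0 < ℓ₀ e)
    (Z₀ : TropicalTorusCycle (2 * 3) 3 (prymPeriod fun e => (ℓ₀ e : ℝ)))
    (hW : weilFunctional Z₀ ≠ 0)
    (hsec : ∀ e : Fin 9, ∃ (v : Fin Z₀.numCells → Fin (3 + 1) → Fin (2 * 3) → ℝ)
        (T : Fin Z₀.numCells → Matrix (Fin 3) (Fin 3) ℝ)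
        (r : Fin Z₀.numFacetClasses → Fin 3 → Fin (2 * 3) → ℝ),
        (∀ (σ : Fin Z₀.numCells) (j : Fin 3) (a : Fin (2 * 3)),
            v σ j.succ a - v σ 0 a = ∑ m, ((Z₀.cell σ).frame a m : ℝ) * T σ m j) ∧
        (∀ (σ : Fin Z₀.numCells) (i : Fin (3 + 1)) (j : Fin 3) (a : Fin (2 * 3)),
            v σ (i.succAbove (Z₀.facetPerm σ i j)) a =
              r (Z₀.facetClass σ i) j a + ∑ b, QR e a b * (Z₀.facetShift σ i b : ℝ))) :
    TropicalSchoenCalibrationThree := by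
  classical
  have hQ₀S : (prymPeriod fun e => (ℓ₀ e : ℝ)).IsSymm := prymPeriod_isSymm _
  have hQ₀J : (prymPeriod fun e => (ℓ₀ e : ℝ)) * (weilJ 3 : Matrix (Fin 6) (Fin 6) ℝ) =
      (weilJ 3 : Matrix (Fin 6) (Fin 6) ℝ) * prymPeriod fun e => (ℓ₀ e : ℝ) :=
    prymPeriod_mul_weilJ _
  -- sections in the nine Prym directions give sections in every direction of `Sym_J`
  choose v T r hv hr using hsec
  have hall := linearlyRealisable_of_sections_on_spanning_family Z₀ QR mem_span_QR v T r hv hr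
  obtain ⟨V, Tf, Rf, hTcont, hT1, hreal⟩ := linearSpread hQ₀S hQ₀J Z₀ hall
  -- the Weil expression of the spread data over a period `P`
  let Wx : Matrix (Fin 6) (Fin 6) ℝ → ℂ := fun P =>
    ∑ σ, ((Z₀.cell σ).weight : ℂ) * (((Tf P σ).det / ((3 : ℕ).factorial : ℝ) : ℝ) : ℂ) *
      frameComplexDet 3 (Z₀.cell σ).frame ^ 2
  have hWx_cont : Continuous Wx := by
    refine continuous_finsetSum _ fun σ _ => ?_
    exact (continuous_const.mul (Complex.continuous_ofReal.comp
      ((hTcont σ).matrix_det.div_const _))).mul continuous_const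
  have hWx0 : Wx (prymPeriod fun e => (ℓ₀ e : ℝ)) = weilFunctional Z₀ := by
    simp only [Wx, weilFunctional, TropicalCell.latticeVolume]
    exact Finset.sum_congr rfl fun σ _ => by rw [hT1 σ]
  -- the good set of edge lengths: positive, positive edge determinants, non-zero Weil expression
  set G : Set (Fin 9 → ℝ) := {ℓ | (∀ e, 0 < ℓ e) ∧ (∀ σ, 0 < (Tf (prymPeriod ℓ) σ).det) ∧
    Wx (prymPeriod ℓ) ≠ 0} with hGdef
  have hGopen : IsOpen G := by
    have h1 : IsOpen {ℓ : Fin 9 → ℝ | ∀ e, 0 < ℓ e} := by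
      rw [Set.setOf_forall]
      exact isOpen_iInter_of_finite fun e => isOpen_lt continuous_const (continuous_apply e)
    have h2 : IsOpen {ℓ : Fin 9 → ℝ | ∀ σ, 0 < (Tf (prymPeriod ℓ) σ).det} := by
      rw [Set.setOf_forall]
      exact isOpen_iInter_of_finite fun σ =>
        isOpen_lt continuous_const ((hTcont σ).comp continuous_prymPeriod).matrix_det
    have h3 : IsOpen {ℓ : Fin 9 → ℝ | Wx (prymPeriod ℓ) ≠ 0} :=
      isOpen_ne_fun (hWx_cont.comp continuous_prymPeriod) continuous_const
    simpa only [hGdef, Set.setOf_and] using h1.inter (h2.inter h3)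
  have hℓ₀G : (fun e => (ℓ₀ e : ℝ)) ∈ G := by
    refine ⟨fun e => ?_, fun σ => ?_, ?_⟩
    · show (0 : ℝ) < (ℓ₀ e : ℝ)
      exact_mod_cast hℓ₀ e
    · show 0 < (Tf (prymPeriod fun e => (ℓ₀ e : ℝ)) σ).det
      rw [hT1 σ]
      exact (Z₀.cell σ).edgeCoeff_det_pos
    · show Wx (prymPeriod fun e => (ℓ₀ e : ℝ)) ≠ 0
      rw [hWx0]
      exact hW
  -- an algebraically independent positive `ℓ` in `G`
  obtain ⟨δ, hδ, hball⟩ := Metric.isOpen_iff.1 hGopen _ hℓ₀G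
  obtain ⟨ℓ, hai, hnear⟩ := exists_algebraicIndependent_near ℓ₀ (half_pos hδ)
  have hℓG : ℓ ∈ G := by
    refine hball (Metric.mem_ball.2 ?_)
    have hle : dist ℓ (fun e => (ℓ₀ e : ℝ)) ≤ δ / 2 := by
      refine (dist_pi_le_iff (half_pos hδ).le).2 fun e => ?_
      rw [Real.dist_eq]
      exact hnear e
    linarith
  obtain ⟨hpos, hdet, hWℓ⟩ := hℓG
  -- the realised cycle over `prymPeriod ℓ`
  have hQS : (prymPeriod ℓ).IsSymm := prymPeriod_isSymm ℓ
  have hQJ : prymPeriod ℓ * (weilJ 3 : Matrix (Fin 6) (Fin 6) ℝ) = (weilJ 3 : Matrix (Fin 6) (Fin 6) ℝ) * prymPeriod ℓ :=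
    prymPeriod_mul_weilJ ℓ
  obtain ⟨hvQ, hfe⟩ := hreal (prymPeriod ℓ) hQS hQJ
  refine ⟨ℓ, hpos, hai,
    { numCells := Z₀.numCells
      cell := fun σ =>
        { weight := (Z₀.cell σ).weight
          weight_pos := (Z₀.cell σ).weight_pos
          vertex := V (prymPeriod ℓ) σ
          frame := (Z₀.cell σ).frame
          edgeCoeff := Tf (prymPeriod ℓ) σ
          vertex_succ_sub := hvQ σ
          edgeCoeff_det_pos := hdet σ
          frame_saturated := (Z₀.cell σ).frame_saturated }
      numFacetClasses := Z₀.numFacetClasses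
      refFacet := Rf (prymPeriod ℓ)
      facetClass := Z₀.facetClass
      facetPerm := Z₀.facetPerm
      facetShift := Z₀.facetShift
      facet_eq := hfe
      balanced := Z₀.balanced }, ?_⟩
  exact hWℓ

end PrymThree

end Summit.HodgeConjecture.HodgeConjecture.Theorems.TropicalWeilVanishing

end
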